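import Summits.Ventures.PercRepro.RankLevelSetLevelSevenCube
import Summits.Ventures.PercRepro.RankLevelSetCoreGeneralSharp
import Summits.Ventures.PercRepro.RankLevelSetLevelSevenQuartTailsA

/-!
# PercRepro — THE LARGE-CORANK REGIME AT LEVEL `8` WITH EXACT ARITHMETIC, PART 1: THE INEQUALITY
`2^{p+159}·C(n, 8)/C(p+8, 8) + R₈(n) ≤ Σ_{8 ≤ k ≤ p−1} C(n, k)` FOR EVERY `p ≥ 144`, `n ≥ p + 172`
(p2, gen 34; a feeder for S4 — the top of the `q = 8` window)

The level-`8` twin of RankLevelSetCoreSevenLargeCorankArith: with `#U ≤ #{r = 8} ≤ C(n, 8)·2^151` (the flat bound `f(8) ≤ 159`),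
`#Y ≥ Σ_{8 ≤ k ≤ p−1} C(n, k) − #{r ≤ 8}` and `Φ(p, 8) ≤ 2^{p+8}/C(p+8, 8)`, the regime is the inequality above (`R₈(n)` = the
rank-`≤ 8` sets through the flat bounds `159 / 79 / 39 / 19 / 10 / 6 / 3 / 1`), proved for every `p ≥ 144` and every `n ≥ p + 172`
(`largeEight_all`) by a numerical base at `(p, n) = (144, 316)`, a doubling step in `p` along `n = p + 172`
(`(n + 1)(p + 1) ≤ (n − 7)(p + 9)`, `R₈(n + 1) ≤ 2·R₈(n)`, Pascal on the mid sum) and a monotonicity step in `n` (every term of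
the left side grows by at most the factor `(n + 1)/(n − 7)` of `C(n, 8)`, every term of the right side by at least it). The
record's floor at this corank was `186` (`c025_core_eight_beyond_sharp`, the same regime-II slack). Part 2
(RankLevelSetCoreEightLargeCorank) applies it to the core. Axioms: standard.
-/

set_option exponentiation.threshold 1024

namespace PercRepro

namespace ThmN

open Set

variable {α : Type}

/-- `C(n+1, k)·(n − 7) ≤ C(n, k)·(n + 1)` for `k ≤ 8` (`C(n, k)(n + 1) = C(n+1, k)(n + 1 − k)`). -/
theorem choose_succ_mul_sub_seven_le (n k : ℕ) (hk : k ≤ 8) :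
    (n + 1).choose k * (n - 7) ≤ n.choose k * (n + 1) := by
  have h := Nat.choose_mul_succ_eq n k
  calc (n + 1).choose k * (n - 7) ≤ (n + 1).choose k * (n + 1 - k) := Nat.mul_le_mul_left _ (by omega)
    _ = n.choose k * (n + 1) := h.symm

/-- `C(n, k)·(n + 1) ≤ C(n+1, k)·(n − 7)` for `8 ≤ k`. -/
theorem choose_mul_succ_le_choose_succ_mul_sub_seven (n k : ℕ) (hk : 8 ≤ k) :
    n.choose k * (n + 1) ≤ (n + 1).choose k * (n - 7) := by
  have h := Nat.choose_mul_succ_eq n k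
  calc n.choose k * (n + 1) = (n + 1).choose k * (n + 1 - k) := h
    _ ≤ (n + 1).choose k * (n - 7) := Nat.mul_le_mul_left _ (by omega)

/-- `C(n+1, 8)·(n − 7) = C(n, 8)·(n + 1)` for `n ≥ 8`. -/
theorem choose_succ_eight_mul_sub_seven (n : ℕ) (hn : 7 ≤ n) :
    (n + 1).choose 8 * (n - 7) = n.choose 8 * (n + 1) := by
  have h := Nat.choose_mul_succ_eq n 8
  rw [show n + 1 - 8 = n - 7 by omega] at h
  exact h.symm

/-- **The flat tail `R₈` grows by at most the factor `(n + 1)/(n − 7)`**: `R₈(n+1)·(n − 7) ≤ R₈(n)·(n + 1)`. -/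
theorem flatTail_eight_succ_mul_sub_seven_le (n : ℕ) :
    ((n + 1).choose 8 * 2 ^ 151 + (n + 1).choose 7 * 2 ^ 72 + (n + 1).choose 6 * 2 ^ 33 + (n + 1).choose 5 * 2 ^ 14 + (n + 1).choose 4 * 2 ^ 6 +
      (n + 1).choose 3 * 2 ^ 3 + (n + 1).choose 2 * 2 + (n + 1) + 1) * (n - 7) ≤
    (n.choose 8 * 2 ^ 151 + n.choose 7 * 2 ^ 72 + n.choose 6 * 2 ^ 33 + n.choose 5 * 2 ^ 14 + n.choose 4 * 2 ^ 6 +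
      n.choose 3 * 2 ^ 3 + n.choose 2 * 2 + n + 1) * (n + 1) := by
  have h8 := choose_succ_mul_sub_seven_le n 8 (by norm_num)
  have h7 := choose_succ_mul_sub_seven_le n 7 (by norm_num)
  have h6 := choose_succ_mul_sub_seven_le n 6 (by norm_num)
  have h5 := choose_succ_mul_sub_seven_le n 5 (by norm_num)
  have h4 := choose_succ_mul_sub_seven_le n 4 (by norm_num)
  have h3 := choose_succ_mul_sub_seven_le n 3 (by norm_num)
  have h2 := choose_succ_mul_sub_seven_le n 2 (by norm_num)
  have h1 : (n + 1) * (n - 7) ≤ n * (n + 1) := by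
    calc (n + 1) * (n - 7) = (n - 7) * (n + 1) := by ring
      _ ≤ n * (n + 1) := Nat.mul_le_mul_right _ (by omega)
  have h0 : 1 * (n - 7) ≤ 1 * (n + 1) := by omega
  calc ((n + 1).choose 8 * 2 ^ 151 + (n + 1).choose 7 * 2 ^ 72 + (n + 1).choose 6 * 2 ^ 33 + (n + 1).choose 5 * 2 ^ 14 + (n + 1).choose 4 * 2 ^ 6 +
        (n + 1).choose 3 * 2 ^ 3 + (n + 1).choose 2 * 2 + (n + 1) + 1) * (n - 7)
      = ((n + 1).choose 8 * (n - 7)) * 2 ^ 151 + ((n + 1).choose 7 * (n - 7)) * 2 ^ 72 + ((n + 1).choose 6 * (n - 7)) * 2 ^ 33 +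
        ((n + 1).choose 5 * (n - 7)) * 2 ^ 14 + ((n + 1).choose 4 * (n - 7)) * 2 ^ 6 +
        ((n + 1).choose 3 * (n - 7)) * 2 ^ 3 + ((n + 1).choose 2 * (n - 7)) * 2 + (n + 1) * (n - 7) +
        1 * (n - 7) := by ring
    _ ≤ (n.choose 8 * (n + 1)) * 2 ^ 151 + (n.choose 7 * (n + 1)) * 2 ^ 72 + (n.choose 6 * (n + 1)) * 2 ^ 33 +
        (n.choose 5 * (n + 1)) * 2 ^ 14 + (n.choose 4 * (n + 1)) * 2 ^ 6 +
        (n.choose 3 * (n + 1)) * 2 ^ 3 + (n.choose 2 * (n + 1)) * 2 + n * (n + 1) + 1 * (n + 1) := by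
        gcongr
    _ = (n.choose 8 * 2 ^ 151 + n.choose 7 * 2 ^ 72 + n.choose 6 * 2 ^ 33 + n.choose 5 * 2 ^ 14 + n.choose 4 * 2 ^ 6 +
        n.choose 3 * 2 ^ 3 + n.choose 2 * 2 + n + 1) * (n + 1) := by ring

/-- **The flat tail at most doubles**: `R₈(n+1) ≤ 2·R₈(n)` for `n ≥ 16`. -/
theorem flatTail_eight_succ_le_two_mul (n : ℕ) (hn : 16 ≤ n) :
    (n + 1).choose 8 * 2 ^ 151 + (n + 1).choose 7 * 2 ^ 72 + (n + 1).choose 6 * 2 ^ 33 + (n + 1).choose 5 * 2 ^ 14 + (n + 1).choose 4 * 2 ^ 6 +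
      (n + 1).choose 3 * 2 ^ 3 + (n + 1).choose 2 * 2 + (n + 1) + 1 ≤
    2 * (n.choose 8 * 2 ^ 151 + n.choose 7 * 2 ^ 72 + n.choose 6 * 2 ^ 33 + n.choose 5 * 2 ^ 14 + n.choose 4 * 2 ^ 6 +
      n.choose 3 * 2 ^ 3 + n.choose 2 * 2 + n + 1) := by
  have h8 := choose_succ_le_two_mul_of_two_mul_le_cube n 8 (by omega)
  have h7 := choose_succ_le_two_mul_of_two_mul_le_cube n 7 (by omega)
  have h6 := choose_succ_le_two_mul_of_two_mul_le_cube n 6 (by omega)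
  have h5 := choose_succ_le_two_mul_of_two_mul_le_cube n 5 (by omega)
  have h4 := choose_succ_le_two_mul_of_two_mul_le_cube n 4 (by omega)
  have h3 := choose_succ_le_two_mul_of_two_mul_le_cube n 3 (by omega)
  have h2 := choose_succ_le_two_mul_of_two_mul_le_cube n 2 (by omega)
  nlinarith [h8, h7, h6, h5, h4, h3, h2]

/-- The mid sum grows by at least the factor `(n + 1)/(n − 7)`: `Σ_{k ∈ Ico 8 p} C(n, k)·(n + 1) ≤ Σ_{k ∈ Ico 8 p} C(n+1, k)·(n − 7)`. -/
theorem sum_Ico_choose_mul_succ_le_sum_succ_mul_sub_seven_eight (n p : ℕ) :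
    (∑ k ∈ Finset.Ico 8 p, n.choose k) * (n + 1) ≤ (∑ k ∈ Finset.Ico 8 p, (n + 1).choose k) * (n - 7) := by
  rw [Finset.sum_mul, Finset.sum_mul]
  apply Finset.sum_le_sum
  intro k hk
  rw [Finset.mem_Ico] at hk
  exact choose_mul_succ_le_choose_succ_mul_sub_seven n k hk.1

/-- **Pascal on the mid sum**: `Σ_{k ∈ Ico 8 (p+1)} C(n+1, k) = 2·Σ_{k ∈ Ico 8 p} C(n, k) + C(n, p) + C(n, 7)` for `8 ≤ p`. -/
theorem sum_Ico_choose_succ_eq_two_mul_add_eight (n p : ℕ) (hp : 8 ≤ p) :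
    ∑ k ∈ Finset.Ico 8 (p + 1), (n + 1).choose k =
      2 * ∑ k ∈ Finset.Ico 8 p, n.choose k + n.choose p + n.choose 7 := by
  induction p, hp using Nat.le_induction with
  | base =>
    rw [Finset.sum_Ico_succ_top (le_refl 8), Finset.Ico_self, Finset.sum_empty, Finset.sum_empty,
      show (8 : ℕ) = 7 + 1 from rfl, Nat.choose_succ_succ]
    ring
  | succ p hp ih =>
    rw [Finset.sum_Ico_succ_top (by omega : 8 ≤ p + 1), ih, Finset.sum_Ico_succ_top (by omega : 8 ≤ p),
      Nat.choose_succ_succ]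
    ring

/-- The mid sum at least doubles: `2·Σ_{k ∈ Ico 8 p} C(n, k) ≤ Σ_{k ∈ Ico 8 (p+1)} C(n+1, k)` for `8 ≤ p`. -/
theorem two_mul_sum_Ico_choose_le_sum_succ_eight (n p : ℕ) (hp : 8 ≤ p) :
    2 * ∑ k ∈ Finset.Ico 8 p, n.choose k ≤ ∑ k ∈ Finset.Ico 8 (p + 1), (n + 1).choose k := by
  rw [sum_Ico_choose_succ_eq_two_mul_add_eight n p hp]
  omega

/-- `C(n+1, 8)·C(p+8, 8) ≤ C(n, 8)·C(p+9, 8)` once `p + 8 ≤ n` (the ratio `(n+1)(p+1)/((n−7)(p+9)) ≤ 1`). -/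
theorem choose_succ_eight_mul_le (n p : ℕ) (hn : p + 8 ≤ n) :
    (n + 1).choose 8 * (p + 8).choose 8 ≤ n.choose 8 * (p + 9).choose 8 := by
  have e1 := choose_succ_eight_mul_sub_seven n (by omega)
  have e2 : (p + 9).choose 8 * (p + 1) = (p + 8).choose 8 * (p + 9) := by
    have h := Nat.choose_mul_succ_eq (p + 8) 8
    rw [show p + 8 + 1 - 8 = p + 1 by omega, show p + 8 + 1 = p + 9 by omega] at h
    exact h.symm
  have hpos : 0 < (n - 7) * (p + 1) := by
    have : 0 < n - 7 := by omega
    positivity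
  apply Nat.le_of_mul_le_mul_right _ hpos
  calc (n + 1).choose 8 * (p + 8).choose 8 * ((n - 7) * (p + 1))
      = ((n + 1).choose 8 * (n - 7)) * (p + 8).choose 8 * (p + 1) := by ring
    _ = (n.choose 8 * (n + 1)) * (p + 8).choose 8 * (p + 1) := by rw [e1]
    _ = n.choose 8 * (p + 8).choose 8 * ((n + 1) * (p + 1)) := by ring
    _ ≤ n.choose 8 * (p + 8).choose 8 * ((n - 7) * (p + 9)) := by
        apply Nat.mul_le_mul_left
        have h1 : (n + 1) * (p + 1) = n * p + n + p + 1 := by ring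
        have h2 : (n - 7) * (p + 9) = n * p + 9 * n - 7 * p - 63 := by
          obtain ⟨m, rfl⟩ : ∃ m, n = m + 7 := ⟨n - 7, by omega⟩
          rw [show m + 7 - 7 = m by omega]
          have : (m + 7) * p + 9 * (m + 7) - 7 * p - 63 = m * p + 9 * m := by
            have : (m + 7) * p + 9 * (m + 7) = m * p + 9 * m + 7 * p + 63 := by ring
            omega
          rw [this]; ring
        have h3 : n * p + n + p + 1 ≤ n * p + 9 * n - 7 * p - 63 := by
          have : 8 * p + 64 ≤ 8 * n := by omega
          have h4 : n * p + 9 * n ≥ 7 * p + 63 := by nlinarith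
          omega
        omega
    _ = n.choose 8 * ((p + 8).choose 8 * (p + 9)) * (n - 7) := by ring
    _ = n.choose 8 * ((p + 9).choose 8 * (p + 1)) * (n - 7) := by rw [e2]
    _ = n.choose 8 * (p + 9).choose 8 * ((n - 7) * (p + 1)) := by ring

/-- **The base `(p, n) = (144, 316)`** of the level-`8` large-corank inequality. -/
theorem largeEight_base :
    (2 : ℚ) ^ (144 + 159) * ((144 + 172).choose 8 : ℚ) / ((144 + 8).choose 8 : ℚ) +
    (((144 + 172).choose 8 * 2 ^ 151 + (144 + 172).choose 7 * 2 ^ 72 + (144 + 172).choose 6 * 2 ^ 33 + (144 + 172).choose 5 * 2 ^ 14 + (144 + 172).choose 4 * 2 ^ 6 +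
      (144 + 172).choose 3 * 2 ^ 3 + (144 + 172).choose 2 * 2 + (144 + 172) + 1 : ℕ) : ℚ) ≤
    ((∑ k ∈ Finset.Ico 8 144, (144 + 172).choose k : ℕ) : ℚ) := by
  rw [Finset.sum_Ico_eq_sum_range]
  simp only [Finset.sum_range_succ, Finset.sum_range_zero, Nat.choose_eq_descFactorial_div_factorial]
  norm_num

/-- **The step in `n`**: the inequality at `(p, n)` gives it at `(p, n + 1)` for `n ≥ 8`. -/
theorem largeEight_step_n (p n : ℕ) (hn : 8 ≤ n)
    (h : (2 : ℚ) ^ (p + 159) * (n.choose 8 : ℚ) / ((p + 8).choose 8 : ℚ) +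
      ((n.choose 8 * 2 ^ 151 + n.choose 7 * 2 ^ 72 + n.choose 6 * 2 ^ 33 + n.choose 5 * 2 ^ 14 + n.choose 4 * 2 ^ 6 +
        n.choose 3 * 2 ^ 3 + n.choose 2 * 2 + n + 1 : ℕ) : ℚ) ≤
      ((∑ k ∈ Finset.Ico 8 p, n.choose k : ℕ) : ℚ)) :
    (2 : ℚ) ^ (p + 159) * ((n + 1).choose 8 : ℚ) / ((p + 8).choose 8 : ℚ) +
    (((n + 1).choose 8 * 2 ^ 151 + (n + 1).choose 7 * 2 ^ 72 + (n + 1).choose 6 * 2 ^ 33 + (n + 1).choose 5 * 2 ^ 14 + (n + 1).choose 4 * 2 ^ 6 +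
      (n + 1).choose 3 * 2 ^ 3 + (n + 1).choose 2 * 2 + (n + 1) + 1 : ℕ) : ℚ) ≤
    ((∑ k ∈ Finset.Ico 8 p, (n + 1).choose k : ℕ) : ℚ) := by
  have hc : (0 : ℚ) < ((p + 8).choose 8 : ℚ) := by exact_mod_cast Nat.choose_pos (by omega)
  have hm : (0 : ℚ) < ((n - 7 : ℕ) : ℚ) := by exact_mod_cast (show 0 < n - 7 by omega)
  have e7 : (((n + 1).choose 8 : ℕ) : ℚ) * ((n - 7 : ℕ) : ℚ) = (n.choose 8 : ℚ) * ((n + 1 : ℕ) : ℚ) := by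
    exact_mod_cast choose_succ_eight_mul_sub_seven n (by omega)
  have hR : (((n + 1).choose 8 * 2 ^ 151 + (n + 1).choose 7 * 2 ^ 72 + (n + 1).choose 6 * 2 ^ 33 + (n + 1).choose 5 * 2 ^ 14 +
      (n + 1).choose 4 * 2 ^ 6 + (n + 1).choose 3 * 2 ^ 3 + (n + 1).choose 2 * 2 + (n + 1) + 1 : ℕ) : ℚ) *
      ((n - 7 : ℕ) : ℚ) ≤
      ((n.choose 8 * 2 ^ 151 + n.choose 7 * 2 ^ 72 + n.choose 6 * 2 ^ 33 + n.choose 5 * 2 ^ 14 + n.choose 4 * 2 ^ 6 +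
        n.choose 3 * 2 ^ 3 + n.choose 2 * 2 + n + 1 : ℕ) : ℚ) * ((n + 1 : ℕ) : ℚ) := by
    exact_mod_cast flatTail_eight_succ_mul_sub_seven_le n
  have hS : ((∑ k ∈ Finset.Ico 8 p, n.choose k : ℕ) : ℚ) * ((n + 1 : ℕ) : ℚ) ≤
      ((∑ k ∈ Finset.Ico 8 p, (n + 1).choose k : ℕ) : ℚ) * ((n - 7 : ℕ) : ℚ) := by
    exact_mod_cast sum_Ico_choose_mul_succ_le_sum_succ_mul_sub_seven_eight n p
  -- multiply the target by `n − 7 > 0`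
  apply le_of_mul_le_mul_right _ hm
  have hT : (2 : ℚ) ^ (p + 159) * (((n + 1).choose 8 : ℕ) : ℚ) / ((p + 8).choose 8 : ℚ) * ((n - 7 : ℕ) : ℚ) =
      (2 : ℚ) ^ (p + 159) * (n.choose 8 : ℚ) / ((p + 8).choose 8 : ℚ) * ((n + 1 : ℕ) : ℚ) := by
    rw [mul_div_assoc, mul_div_assoc, mul_assoc, mul_assoc, div_mul_eq_mul_div, div_mul_eq_mul_div, e7]
  calc ((2 : ℚ) ^ (p + 159) * (((n + 1).choose 8 : ℕ) : ℚ) / ((p + 8).choose 8 : ℚ) +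
        (((n + 1).choose 8 * 2 ^ 151 + (n + 1).choose 7 * 2 ^ 72 + (n + 1).choose 6 * 2 ^ 33 + (n + 1).choose 5 * 2 ^ 14 +
          (n + 1).choose 4 * 2 ^ 6 + (n + 1).choose 3 * 2 ^ 3 + (n + 1).choose 2 * 2 + (n + 1) + 1 : ℕ) : ℚ)) *
        ((n - 7 : ℕ) : ℚ)
      = (2 : ℚ) ^ (p + 159) * (((n + 1).choose 8 : ℕ) : ℚ) / ((p + 8).choose 8 : ℚ) * ((n - 7 : ℕ) : ℚ) +
        (((n + 1).choose 8 * 2 ^ 151 + (n + 1).choose 7 * 2 ^ 72 + (n + 1).choose 6 * 2 ^ 33 + (n + 1).choose 5 * 2 ^ 14 +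
          (n + 1).choose 4 * 2 ^ 6 + (n + 1).choose 3 * 2 ^ 3 + (n + 1).choose 2 * 2 + (n + 1) + 1 : ℕ) : ℚ) *
        ((n - 7 : ℕ) : ℚ) := by ring
    _ ≤ (2 : ℚ) ^ (p + 159) * (n.choose 8 : ℚ) / ((p + 8).choose 8 : ℚ) * ((n + 1 : ℕ) : ℚ) +
        ((n.choose 8 * 2 ^ 151 + n.choose 7 * 2 ^ 72 + n.choose 6 * 2 ^ 33 + n.choose 5 * 2 ^ 14 + n.choose 4 * 2 ^ 6 +
          n.choose 3 * 2 ^ 3 + n.choose 2 * 2 + n + 1 : ℕ) : ℚ) * ((n + 1 : ℕ) : ℚ) := by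
        rw [hT]; exact add_le_add le_rfl hR
    _ = ((2 : ℚ) ^ (p + 159) * (n.choose 8 : ℚ) / ((p + 8).choose 8 : ℚ) +
        ((n.choose 8 * 2 ^ 151 + n.choose 7 * 2 ^ 72 + n.choose 6 * 2 ^ 33 + n.choose 5 * 2 ^ 14 + n.choose 4 * 2 ^ 6 +
          n.choose 3 * 2 ^ 3 + n.choose 2 * 2 + n + 1 : ℕ) : ℚ)) * ((n + 1 : ℕ) : ℚ) := by ring
    _ ≤ ((∑ k ∈ Finset.Ico 8 p, n.choose k : ℕ) : ℚ) * ((n + 1 : ℕ) : ℚ) := by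
        apply mul_le_mul_of_nonneg_right h (by positivity)
    _ ≤ ((∑ k ∈ Finset.Ico 8 p, (n + 1).choose k : ℕ) : ℚ) * ((n - 7 : ℕ) : ℚ) := hS

/-- **The step in `p` along `n = p + D`**: the inequality at `(p, n)` gives it at `(p + 1, n + 1)` for `8 ≤ p`, `p + 8 ≤ n`,
`16 ≤ n`. -/
theorem largeEight_step_p (p n : ℕ) (hp : 8 ≤ p) (hn : p + 8 ≤ n) (hn16 : 16 ≤ n)
    (h : (2 : ℚ) ^ (p + 159) * (n.choose 8 : ℚ) / ((p + 8).choose 8 : ℚ) +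
      ((n.choose 8 * 2 ^ 151 + n.choose 7 * 2 ^ 72 + n.choose 6 * 2 ^ 33 + n.choose 5 * 2 ^ 14 + n.choose 4 * 2 ^ 6 +
        n.choose 3 * 2 ^ 3 + n.choose 2 * 2 + n + 1 : ℕ) : ℚ) ≤
      ((∑ k ∈ Finset.Ico 8 p, n.choose k : ℕ) : ℚ)) :
    (2 : ℚ) ^ ((p + 1) + 159) * ((n + 1).choose 8 : ℚ) / (((p + 1) + 8).choose 8 : ℚ) +
    (((n + 1).choose 8 * 2 ^ 151 + (n + 1).choose 7 * 2 ^ 72 + (n + 1).choose 6 * 2 ^ 33 + (n + 1).choose 5 * 2 ^ 14 + (n + 1).choose 4 * 2 ^ 6 +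
      (n + 1).choose 3 * 2 ^ 3 + (n + 1).choose 2 * 2 + (n + 1) + 1 : ℕ) : ℚ) ≤
    ((∑ k ∈ Finset.Ico 8 (p + 1), (n + 1).choose k : ℕ) : ℚ) := by
  have hc : (0 : ℚ) < ((p + 8).choose 8 : ℚ) := by exact_mod_cast Nat.choose_pos (by omega)
  have hc' : (0 : ℚ) < ((p + 1 + 8).choose 8 : ℚ) := by exact_mod_cast Nat.choose_pos (by omega)
  -- (a) the first term at most doubles
  have ha : (2 : ℚ) ^ (p + 1 + 159) * (((n + 1).choose 8 : ℕ) : ℚ) / ((p + 1 + 8).choose 8 : ℚ) ≤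
      2 * ((2 : ℚ) ^ (p + 159) * (n.choose 8 : ℚ) / ((p + 8).choose 8 : ℚ)) := by
    have hk : (((n + 1).choose 8 : ℕ) : ℚ) * ((p + 8).choose 8 : ℚ) ≤ (n.choose 8 : ℚ) * ((p + 9).choose 8 : ℚ) := by
      exact_mod_cast choose_succ_eight_mul_le n p hn
    have hc8 : (0 : ℚ) < ((p + 9).choose 8 : ℚ) := by exact_mod_cast Nat.choose_pos (by omega)
    have e1 : (2 : ℚ) ^ (p + 1 + 159) * (((n + 1).choose 8 : ℕ) : ℚ) / ((p + 1 + 8).choose 8 : ℚ) =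
        ((2 : ℚ) ^ (p + 160) / (((p + 8).choose 8 : ℚ) * ((p + 9).choose 8 : ℚ))) *
          ((((n + 1).choose 8 : ℕ) : ℚ) * ((p + 8).choose 8 : ℚ)) := by
      rw [show p + 1 + 8 = p + 9 by ring, show p + 1 + 159 = p + 160 by ring]
      field_simp
    have e2 : 2 * ((2 : ℚ) ^ (p + 159) * (n.choose 8 : ℚ) / ((p + 8).choose 8 : ℚ)) =
        ((2 : ℚ) ^ (p + 160) / (((p + 8).choose 8 : ℚ) * ((p + 9).choose 8 : ℚ))) *
          ((n.choose 8 : ℚ) * ((p + 9).choose 8 : ℚ)) := by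
      rw [show p + 160 = p + 159 + 1 by ring, pow_succ]
      field_simp
      ring
    rw [e1, e2]
    exact mul_le_mul_of_nonneg_left hk (by positivity)
  -- (b) the flat tail at most doubles
  have hb : (((n + 1).choose 8 * 2 ^ 151 + (n + 1).choose 7 * 2 ^ 72 + (n + 1).choose 6 * 2 ^ 33 + (n + 1).choose 5 * 2 ^ 14 +
      (n + 1).choose 4 * 2 ^ 6 + (n + 1).choose 3 * 2 ^ 3 + (n + 1).choose 2 * 2 + (n + 1) + 1 : ℕ) : ℚ) ≤
      2 * ((n.choose 8 * 2 ^ 151 + n.choose 7 * 2 ^ 72 + n.choose 6 * 2 ^ 33 + n.choose 5 * 2 ^ 14 + n.choose 4 * 2 ^ 6 +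
        n.choose 3 * 2 ^ 3 + n.choose 2 * 2 + n + 1 : ℕ) : ℚ) := by
    exact_mod_cast flatTail_eight_succ_le_two_mul n hn16
  -- (c) the mid sum at least doubles
  have hcc : 2 * ((∑ k ∈ Finset.Ico 8 p, n.choose k : ℕ) : ℚ) ≤
      ((∑ k ∈ Finset.Ico 8 (p + 1), (n + 1).choose k : ℕ) : ℚ) := by
    exact_mod_cast two_mul_sum_Ico_choose_le_sum_succ_eight n p hp
  calc (2 : ℚ) ^ (p + 1 + 159) * (((n + 1).choose 8 : ℕ) : ℚ) / ((p + 1 + 8).choose 8 : ℚ) +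
        (((n + 1).choose 8 * 2 ^ 151 + (n + 1).choose 7 * 2 ^ 72 + (n + 1).choose 6 * 2 ^ 33 + (n + 1).choose 5 * 2 ^ 14 +
          (n + 1).choose 4 * 2 ^ 6 + (n + 1).choose 3 * 2 ^ 3 + (n + 1).choose 2 * 2 + (n + 1) + 1 : ℕ) : ℚ)
      ≤ 2 * ((2 : ℚ) ^ (p + 159) * (n.choose 8 : ℚ) / ((p + 8).choose 8 : ℚ)) +
        2 * ((n.choose 8 * 2 ^ 151 + n.choose 7 * 2 ^ 72 + n.choose 6 * 2 ^ 33 + n.choose 5 * 2 ^ 14 + n.choose 4 * 2 ^ 6 +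
          n.choose 3 * 2 ^ 3 + n.choose 2 * 2 + n + 1 : ℕ) : ℚ) := add_le_add ha hb
    _ = 2 * ((2 : ℚ) ^ (p + 159) * (n.choose 8 : ℚ) / ((p + 8).choose 8 : ℚ) +
        ((n.choose 8 * 2 ^ 151 + n.choose 7 * 2 ^ 72 + n.choose 6 * 2 ^ 33 + n.choose 5 * 2 ^ 14 + n.choose 4 * 2 ^ 6 +
          n.choose 3 * 2 ^ 3 + n.choose 2 * 2 + n + 1 : ℕ) : ℚ)) := by ring
    _ ≤ 2 * ((∑ k ∈ Finset.Ico 8 p, n.choose k : ℕ) : ℚ) := mul_le_mul_of_nonneg_left h (by norm_num)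
    _ ≤ ((∑ k ∈ Finset.Ico 8 (p + 1), (n + 1).choose k : ℕ) : ℚ) := hcc

/-- **The level-`8` large-corank inequality for every `p ≥ 144` and every `n ≥ p + 172`** (the base `(144, 316)`, the steps). -/
theorem largeEight_all (p : ℕ) (hp : 144 ≤ p) (n : ℕ) (hn : p + 172 ≤ n) :
    (2 : ℚ) ^ (p + 159) * (n.choose 8 : ℚ) / ((p + 8).choose 8 : ℚ) +
    ((n.choose 8 * 2 ^ 151 + n.choose 7 * 2 ^ 72 + n.choose 6 * 2 ^ 33 + n.choose 5 * 2 ^ 14 + n.choose 4 * 2 ^ 6 +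
      n.choose 3 * 2 ^ 3 + n.choose 2 * 2 + n + 1 : ℕ) : ℚ) ≤
    ((∑ k ∈ Finset.Ico 8 p, n.choose k : ℕ) : ℚ) := by
  have hdiag : ∀ p, 144 ≤ p → (2 : ℚ) ^ (p + 159) * ((p + 172).choose 8 : ℚ) / ((p + 8).choose 8 : ℚ) +
      (((p + 172).choose 8 * 2 ^ 151 + (p + 172).choose 7 * 2 ^ 72 + (p + 172).choose 6 * 2 ^ 33 + (p + 172).choose 5 * 2 ^ 14 + (p + 172).choose 4 * 2 ^ 6 +
        (p + 172).choose 3 * 2 ^ 3 + (p + 172).choose 2 * 2 + (p + 172) + 1 : ℕ) : ℚ) ≤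
      ((∑ k ∈ Finset.Ico 8 p, (p + 172).choose k : ℕ) : ℚ) := by
    intro p hp
    induction p, hp using Nat.le_induction with
    | base => exact largeEight_base
    | succ p hp ih =>
      rw [show p + 1 + 172 = p + 172 + 1 by ring]
      exact largeEight_step_p p (p + 172) (by omega) (by omega) (by omega) ih
  have hall : ∀ n, p + 172 ≤ n → (2 : ℚ) ^ (p + 159) * (n.choose 8 : ℚ) / ((p + 8).choose 8 : ℚ) +
      ((n.choose 8 * 2 ^ 151 + n.choose 7 * 2 ^ 72 + n.choose 6 * 2 ^ 33 + n.choose 5 * 2 ^ 14 + n.choose 4 * 2 ^ 6 +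
        n.choose 3 * 2 ^ 3 + n.choose 2 * 2 + n + 1 : ℕ) : ℚ) ≤
      ((∑ k ∈ Finset.Ico 8 p, n.choose k : ℕ) : ℚ) := by
    intro n hn
    induction n, hn using Nat.le_induction with
    | base => exact hdiag p hp
    | succ n hn ih => exact largeEight_step_n p n (by omega) ih
  exact hall n hn

end ThmN

end PercRepro
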